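import Literature.Barriers.RiemannHypothesis.BestTrudgian2015Matching
import Literature.NumberTheory.LFunctions.InghamSmoothingAveraging
import HarnessLib

/-!
# Best–Trudgian 2015, Theorem 2 for `M` (Anderson–Stark), proved: discharge of `BestTrudgian2015_thm2M`

Barrier catalogue `Literature/Barriers/RiemannHypothesis/` (D-0021), support file for the entry
`MertensDisproof`. Discharges the named fact

> `Literature.Barriers.RiemannHypothesis.BestTrudgian2015_thm2M` (`BestTrudgian2015.lean`) — Best–Trudgian 2015, Theorem 2
> (R. J. Anderson, H. M. Stark 1981) applied to `g = M` as in §2.1, with the kernel `f₀` of §3.2: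
> under RH and the simplicity of the zeros, if `Γ' ⊂ Γ ∩ (0,T)` is `{N_γ}`-independent in
> `Γ ∩ [0,T]` then `limsup M(x)x^{-1/2} ≥ Σ_{γ∈Γ'} (2N_γ/(N_γ+1)) f₀(γ)/|ρζ'(ρ)|` and
> `liminf ≤ −Σ …`

(`BestTrudgian2015_thm2M_holds`), so that Theorem 1 of the source (`BestTrudgian2015_thm1`:
`limsup ≥ 1.6383`, `liminf ≤ −1.6383`) rests on the LLL computation of its Theorem 4 alone:
`BestTrudgian2015_thm1_of_certificate` derives `BestTrudgian2015_thm1` from the printed data of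
Theorem 4 — a height `T > 0` that is not an ordinate, a finite set `Γ'` of ordinates in `(0, T)`,
an integer `N ≥ 1` with `Γ'` `{N}`-independent in `Γ ∩ [0, T]` (Definition 1), and the evaluated
sum `Σ_{γ∈Γ'} (2N/(N+1)) f₀(γ)/|ρζ'(ρ)| ≥ 1.6383` — taken as explicit hypotheses. (§3.4, Theorem 4:
"Let `Γ'` be the heaviest 500 zeroes with `T = γ₂₀₀₁ − ε`. Then the elements of `Γ'` are
`{N_γ}`-independent, where all `N_γ`s are `4976`", from an LLL reduction with the zeros to
`k = 9000` digits. Theorem 4 enters this file only through these hypotheses, not through a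
named fact: it is a multiprecision lattice computation that the tree cannot certify — by the
counting heuristic `(2N+1)^n ≈ 10^{2000}`, `{N}`-independence of `n = 500` reals with `|c_γ| ≤ N`
is invisible much below `2000` digits of the `γ`'s, against the `2⁻²⁴⁰`-brackets of
`MertensCertificate.lean` — and its only use in the source is as the input of Theorem 1, whose
named fact `BestTrudgian2015_thm1` already carries that computational debt (D-0026). Its
mathematical content, Theorem 3 with Lemmas 1–3 — Gram–Schmidt bounds for some basis of each
lattice `L(K; ·)` certify `{N_γ}`-independence — is proved in
`ZetaZeroLinearRelations(Certificate).lean`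
(`Literature.NumberTheory.LFunctions.BestTrudgian.nIndependent_of_gramSchmidt_bounds`).)

## Proof (Ingham 1942; Anderson–Stark 1981; Best–Trudgian §2)

All analytic inputs are the tree's, from the Odlyzko–te Riele cluster: Landau's theorem and the
Laplace transform `1/((½+s)ζ(½+s))` of `m(u) = M(e^u)e^{-u/2}` under a one-sided bound
(`normalizedMertens_laplace_of_oneSided`), the regular part at simple zeros on the line
(`exists_regularPart`), the Jurkat–Peyerimhoff kernel `K_T` with transform `g(t/T)`
(`kernelTransform_jurkatPeyerimhoffSmoothing`) and its dilation `K_c(y) = K_T(y/c)/c`, `c > 1`,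
whose transform `g(ct/T)` is supported in `[−T/c, T/c] ⊂ (−T, T)` (as in
`OdlyzkoTeRiele1985_kernelTheorem_holds`), and the smoothed explicit formula with the averaging
step of Anderson–Stark (`InghamSmoothing.frequently_gt_and_lt_of_laplace_of_mean`,
`InghamSmoothingAveraging.lean`): `liminf m ≤ M[Q · Re S] ≤ limsup m` for every continuous weight
`Q ≥ 0` of mean one. The weight is the Fejér product `Q(y) = Π_{γ∈Γ'} F_{N_γ}(γy + θ_γ)`
(`AndersonStark.fejerProd`), whose means are computed in `FejerProductMeans.lean` and matched with
the frequencies `±γ` of `S` through the `{N_γ}`-independence in `BestTrudgian2015Matching.lean`: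
`M[Q] = 1` and `M[Q · Re S] = Σ_{γ∈Γ'} (N_γ/(N_γ+1)) · 2 Re(e^{−iθ_γ} a_ρ) g(cγ/T)`,
`a_ρ = (ρζ'(ρ))⁻¹`, using `a_{ρ̄} = ā_ρ` and the evenness of `g`. The phases `θ_γ = arg a_ρ`
(resp. `arg a_ρ + π`) give `±Σ 2(N_γ/(N_γ+1)) g(cγ/T)|a_ρ|`, and `c → 1⁺` gives the printed bound
by continuity of `g`. The zero clause below `T` comes from RH and simplicity
(`zeros_onLine_simple`); the hypotheses "`T ∉ Γ`" and "`Γ' ≠ ∅`" of the fact are not needed.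

## References

* [BestTrudgian2015] §2: (2.1)–(2.3), Definition 1, Theorem 2, §2.1 (2.7)–(2.9); §3.2 (kernel);
  read from arXiv:1209.3843. R. J. Anderson, H. M. Stark, *Oscillation theorems*, LNM 899 (1981)
  79–106 and [Ingham1942] (cited through it).
* [OdlyzkoTeRiele1985] §2, Theorem p. 144 and §4.1 (the kernel), as formalised in
  `MertensConjectureDisproofProofs.lean`.
-/

noncomputable section

open Complex Filter MeasureTheory Set Topology Finset
open Literature.NumberTheory.LFunctions Literature.NumberTheory.LFunctions.AndersonStark
  Literature.NumberTheory.LFunctions.InghamSmoothing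

namespace Literature.Barriers.RiemannHypothesis

namespace BestTrudgian2015

/-! ## Small lemmas: conjugate coefficients, phases -/

/-- `a_{ρ̄} = ā_ρ` for `a_ρ = (ρζ'(ρ))⁻¹` (`ζ'(s̄) = conj ζ'(s)`). [folklore] -/
theorem coeff_conj (ρ : ℂ) :
    1 / ((starRingEnd ℂ) ρ * deriv riemannZeta ((starRingEnd ℂ) ρ)) =
      (starRingEnd ℂ) (1 / (ρ * deriv riemannZeta ρ)) := by
  rw [deriv_riemannZeta_conj, ← map_mul, map_div₀, map_one]

/-- `e^{−i arg z} z = |z|`. [folklore] -/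
theorem exp_neg_arg_mul (z : ℂ) : cexp (-((Complex.arg z : ℂ) * I)) * z = (‖z‖ : ℂ) := by
  have h : cexp (-((Complex.arg z : ℂ) * I)) * z =
      cexp (-((Complex.arg z : ℂ) * I)) * (‖z‖ * cexp (Complex.arg z * I)) :=
    congrArg (cexp (-((Complex.arg z : ℂ) * I)) * ·) (Complex.norm_mul_exp_arg_mul_I z).symm
  rw [h, mul_left_comm, ← Complex.exp_add, neg_add_cancel, Complex.exp_zero, mul_one]

/-- `e^{−i(arg z + π)} z = −|z|`. [folklore] -/
theorem exp_neg_arg_add_pi_mul (z : ℂ) :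
    cexp (-(((Complex.arg z + Real.pi : ℝ) : ℂ) * I)) * z = -(‖z‖ : ℂ) := by
  have h1 : cexp (-(((Complex.arg z + Real.pi : ℝ) : ℂ) * I)) =
      cexp (-((Complex.arg z : ℂ) * I)) * cexp (-(Real.pi * I)) := by
    rw [← Complex.exp_add]
    congr 1
    push_cast
    ring
  have h2 : cexp (-(Real.pi * I : ℂ)) = -1 := by
    rw [Complex.exp_neg, Complex.exp_pi_mul_I, inv_neg, inv_one]
  rw [h1, h2, mul_assoc, mul_comm (-1 : ℂ), ← mul_assoc, exp_neg_arg_mul]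
  ring

/-- The real part of one term of the matched sum: for real `w, r, θ` and complex `z`,
`Re[w (e^{−iθ} (z r) + e^{iθ} (z̄ r))] = 2 w r Re(e^{−iθ} z)`. [folklore] -/
theorem re_term (w r θ : ℝ) (z : ℂ) :
    ((w : ℂ) * (cexp (-((θ : ℂ) * I)) * (z * r) + cexp ((θ : ℂ) * I) * ((starRingEnd ℂ) z * r))).re =
      2 * w * r * (cexp (-((θ : ℂ) * I)) * z).re := by
  have hconj : cexp ((θ : ℂ) * I) * ((starRingEnd ℂ) z * r) =
      (starRingEnd ℂ) (cexp (-((θ : ℂ) * I)) * (z * r)) := by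
    rw [map_mul, map_mul, Complex.conj_ofReal, ← Complex.exp_conj, map_neg, map_mul,
      Complex.conj_ofReal, Complex.conj_I]
    ring_nf
  rw [hconj, Complex.add_conj, ← Complex.ofReal_mul, Complex.ofReal_re,
    show cexp (-((θ : ℂ) * I)) * (z * r) = (r : ℂ) * (cexp (-((θ : ℂ) * I)) * z) by ring,
    Complex.re_ofReal_mul]
  ring

/-! ## The core: oscillation of `m` about `±Σ 2(N/(N+1)) g(cγ/T)|a_ρ|` for every `c > 1` -/

variable {T : ℝ} {Γ' : Finset ℝ} {N : ℝ → ℕ}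

/-- **Anderson–Stark for `M`, dilated kernel.** Under the zero clause below `T`, for
`Γ' ⊂ Γ ∩ (0,T)` `{N_γ}`-independent in `Γ ∩ [0,T]` (`N_γ ≥ 1`), every `c > 1` and `ε > 0`:
`m(y) > V_c − ε` and `m(y) < −V_c + ε` for arbitrarily large `y`, where
`V_c = Σ_{γ∈Γ'} 2 (N_γ/(N_γ+1)) g(cγ/T) |a_ρ|`, `ρ = ½ + iγ`, `m(y) = M(e^y)e^{-y/2}`.
[cite: BestTrudgian2015, Theorem 2 with §2.1 and §3.2] -/
theorem frequently_normalizedMertens_of_nIndependent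
    (hz : ∀ ρ : ℂ, riemannZeta ρ = 0 → 0 < ρ.re → ρ.re < 1 → |ρ.im| < T →
      ρ.re = 1 / 2 ∧ deriv riemannZeta ρ ≠ 0)
    (hT : 0 < T) (hΓ' : ↑Γ' ⊆ zetaPositiveOrdinates ∩ Set.Ioo 0 T) (hN : ∀ γ ∈ Γ', 0 < N γ)
    (hind : BestTrudgian.NIndependent zetaPositiveOrdinates T Γ' N) {c : ℝ} (hc : 1 < c)
    {ε : ℝ} (hε : 0 < ε) :
    (∃ᶠ y in atTop, (∑ γ ∈ Γ', 2 * ((N γ : ℝ) / (N γ + 1)) *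
        (jurkatPeyerimhoffKernel (c * γ / T) *
          ‖1 / ((1 / 2 + γ * I) * deriv riemannZeta (1 / 2 + γ * I))‖)) - ε < normalizedMertens y) ∧
    (∃ᶠ y in atTop, normalizedMertens y < -(∑ γ ∈ Γ', 2 * ((N γ : ℝ) / (N γ + 1)) *
        (jurkatPeyerimhoffKernel (c * γ / T) *
          ‖1 / ((1 / 2 + γ * I) * deriv riemannZeta (1 / 2 + γ * I))‖)) + ε) := by
  classical
  -- the kernel `K_T` and its dilation
  set K : ℝ → ℝ := jurkatPeyerimhoffSmoothing T with hK
  have hKc : Continuous K := (contDiff_jurkatPeyerimhoffSmoothing T (n := 0)).continuous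
  have hKnn : ∀ y, 0 ≤ K y := jurkatPeyerimhoffSmoothing_nonneg hT.le
  have hKi : Integrable K :=
    integrable_of_even_isBigO hKc (jurkatPeyerimhoffSmoothing_neg T) (jurkatPeyerimhoffSmoothing_isBigO hT)
  have hK1 : ∫ y, K y = 1 :=
    integral_eq_one_of_kernelTransform_zero (kernelTransform_jurkatPeyerimhoffSmoothing_zero hT)
  have hc0 : 0 < c := by linarith
  have hT' : T / c < T := by rw [div_lt_iff₀ hc0]; nlinarith
  set Kc : ℝ → ℝ := fun y ↦ K (y / c) / c with hKc_def
  set kc : ℝ → ℂ := fun t ↦ kernelTransform Kc t with hkc_def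
  have hkc : ∀ t, kc t = ((jurkatPeyerimhoffKernel (c * t / T) : ℝ) : ℂ) := fun t ↦ by
    simp only [hkc_def, hKc_def, hK]
    rw [kernelTransform_dilate hc0, kernelTransform_jurkatPeyerimhoffSmoothing hT, mul_div_assoc]
  have hks : ∀ t, T / c ≤ |t| → kc t = 0 := by
    intro t ht
    simp only [hkc_def, hKc_def, hK]
    rw [kernelTransform_dilate hc0]
    refine kernelTransform_jurkatPeyerimhoffSmoothing_eq_zero hT ?_
    rw [abs_mul, abs_of_pos hc0]
    rwa [div_le_iff₀' hc0] at ht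
  have hKci : Integrable Kc := integrable_dilate hKi hc0
  have hKcc : Continuous Kc := (hKc.comp (continuous_id.div_const c)).div_const c
  have hKc1 : ∫ y, Kc y = 1 := by simp only [hKc_def]; rw [integral_dilate hc0, hK1]
  -- poles, coefficients and the Laplace representation under one-sided bounds
  obtain ⟨R, hRc, hRid⟩ := exists_regularPart hz hT'
  set P := (zetaZerosBelow_finite T).toFinset with hP
  set a : ℂ → ℂ := fun ρ ↦ 1 / (ρ * deriv riemannZeta ρ) with ha
  have hL : ∀ A : ℝ, ((∀ u, normalizedMertens u ≤ A) ∨ (∀ u, -A ≤ normalizedMertens u)) →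
      (∀ σ, 0 < σ → Integrable (fun u ↦ normalizedMertens u * Real.exp (-(σ * u)))) ∧
      ∃ R : ℂ → ℂ, ContinuousOn R (Set.Icc 0 (1 / 4) ×ℂ Set.Icc (-(T / c)) (T / c)) ∧
        ∀ σ t : ℝ, 0 < σ → σ ≤ 1 / 4 → |t| ≤ T / c →
          ∫ u, (normalizedMertens u : ℂ) * cexp (-(((σ : ℂ) + t * I) * u)) =
            ∑ ρ ∈ P, a ρ / ((σ : ℂ) + t * I - ρ.im * I) + R (σ + t * I) := by
    intro A hA
    obtain ⟨hint, hlap⟩ := normalizedMertens_laplace_of_oneSided hA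
    refine ⟨hint, R, hRc, fun σ t hσ hσ' ht ↦ ?_⟩
    rw [hlap σ t hσ (by linarith),
      show (1 / 2 : ℂ) + σ + t * I = 1 / 2 + ((σ : ℂ) + t * I) by ring, hRid σ t hσ hσ' ht]
  -- the weights: mean one, and the matched mean for any phases `θ`
  have hQ1 : ∀ (θ : ℝ → ℝ) (Y : ℝ), Tendsto (fun U : ℝ ↦ U⁻¹ * ∫ y in Y..Y + U,
      fejerProd ((fun j : ↥Γ' ↦ N j.1)) ((fun j : ↥Γ' ↦ (j.1 : ℝ))) ((fun j : ↥Γ' ↦ θ j.1)) y) atTop (𝓝 1) := by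
    intro θ Y
    have h := tendsto_mean_fejerProd ((fun j : ↥Γ' ↦ N j.1)) ((fun j : ↥Γ' ↦ (j.1 : ℝ))) ((fun j : ↥Γ' ↦ θ j.1)) Y
    rwa [sum_freq_zero_eq_one hind θ, Complex.one_re] at h
  have hQS : ∀ (θ : ℝ → ℝ) (Y : ℝ), Tendsto (fun U : ℝ ↦ U⁻¹ * ∫ y in Y..Y + U,
      fejerProd ((fun j : ↥Γ' ↦ N j.1)) ((fun j : ↥Γ' ↦ (j.1 : ℝ))) ((fun j : ↥Γ' ↦ θ j.1)) y *
        (∑ ρ ∈ P, a ρ * kc ρ.im * cexp (((ρ.im * y : ℝ) : ℂ) * I)).re) atTop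
      (𝓝 (∑ γ ∈ Γ', 2 * ((N γ : ℝ) / (N γ + 1)) * (jurkatPeyerimhoffKernel (c * γ / T) *
        (cexp (-((θ γ : ℂ) * I)) * a (1 / 2 + γ * I)).re))) := by
    intro θ Y
    have h := tendsto_mean_fejerProd_mul_re P (fun ρ ↦ ρ.im) (fun ρ ↦ a ρ * kc ρ.im)
      ((fun j : ↥Γ' ↦ N j.1)) ((fun j : ↥Γ' ↦ (j.1 : ℝ))) ((fun j : ↥Γ' ↦ θ j.1)) Y
    rw [sum_match_eq hz hΓ' hN hind θ (fun ρ ↦ a ρ * kc ρ.im), Complex.re_sum] at h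
    convert h using 2 with γ hγ
    refine Finset.sum_congr rfl fun γ _ ↦ ?_
    have him₁ : (1 / 2 + γ * I : ℂ).im = γ := by simp
    have him₂ : (1 / 2 - γ * I : ℂ).im = -γ := by simp
    have hev : jurkatPeyerimhoffKernel (c * -γ / T) = jurkatPeyerimhoffKernel (c * γ / T) := by
      rw [show c * -γ / T = -(c * γ / T) by ring, jurkatPeyerimhoffKernel_neg]
    have hconj : a (1 / 2 - γ * I) = (starRingEnd ℂ) (a (1 / 2 + γ * I)) := by
      simp only [ha]
      rw [← coeff_conj, conj_half_add]
    rw [him₁, him₂, hkc, hkc, hev, hconj,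
      show ((N γ : ℂ) / (N γ + 1)) = (((N γ : ℝ) / (N γ + 1) : ℝ) : ℂ) by push_cast; rfl,
      re_term]
    ring
  -- the abstract theorem, for the two phase choices
  have main := fun θ : ℝ → ℝ ↦ frequently_gt_and_lt_of_laplace_of_mean P (fun ρ : ℂ ↦ ρ.im) a
    (f := normalizedMertens) (K := Kc) (k := kc) (σ₀ := 1 / 4) (T' := T / c)
    measurable_normalizedMertens (fun u hu ↦ normalizedMertens_of_neg hu)
    normalizedMertens_locally_bounded hKcc (fun v ↦ div_nonneg (hKnn _) hc0.le) hKci hKc1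
    (fun t ↦ kernelTransform_eq_integral _ t) hks (by norm_num) hL
    (continuous_fejerProd ((fun j : ↥Γ' ↦ N j.1)) ((fun j : ↥Γ' ↦ (j.1 : ℝ))) ((fun j : ↥Γ' ↦ θ j.1)))
    (fejerProd_nonneg ((fun j : ↥Γ' ↦ N j.1)) ((fun j : ↥Γ' ↦ (j.1 : ℝ))) ((fun j : ↥Γ' ↦ θ j.1))) (hQ1 θ) (hQS θ) hε
  constructor
  · -- phases `θ_γ = arg a_ρ`
    have h := (main fun γ ↦ Complex.arg (a (1 / 2 + γ * I))).1
    refine h.mono fun y hy ↦ ?_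
    convert hy using 4 with γ hγ
    rw [exp_neg_arg_mul, Complex.ofReal_re]
  · -- phases `θ_γ = arg a_ρ + π`
    have h := (main fun γ ↦ Complex.arg (a (1 / 2 + γ * I)) + Real.pi).2
    refine h.mono fun y hy ↦ ?_
    convert hy using 3
    rw [← Finset.sum_neg_distrib]
    refine Finset.sum_congr rfl fun γ _ ↦ ?_
    rw [exp_neg_arg_add_pi_mul, Complex.neg_re, Complex.ofReal_re]
    ring

end BestTrudgian2015

/-! ## The discharge -/

open BestTrudgian2015 in
/-- **Discharge of `BestTrudgian2015_thm2M`: Best–Trudgian 2015, Theorem 2 (Anderson–Stark) for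
`g = M` with the kernel of §3.2, proved.** Under RH and the simplicity of the zeros, if the
non-empty `Γ' ⊂ Γ ∩ (0, T)` (`T` not an ordinate) is `{N_γ}`-independent in `Γ ∩ [0, T]`, then
`limsup M(x)x^{-1/2} ≥ Σ_{γ ∈ Γ'} (2N_γ/(N_γ+1)) f₀(γ)/|ρζ'(ρ)|` and `liminf ≤ −Σ …` (filter-wise).
Proof: `frequently_normalizedMertens_of_nIndependent` for every `c > 1`, and `c → 1⁺` by
continuity of `g`. [cite: BestTrudgian2015, Theorem 2 with §2.1 (2.8)–(2.9) and §3.2] -/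
theorem BestTrudgian2015_thm2M_holds : BestTrudgian2015_thm2M := by
  intro hRH hS T Γ' N hT _ _ hΓ' hN hind
  have hz : ∀ ρ : ℂ, riemannZeta ρ = 0 → 0 < ρ.re → ρ.re < 1 → |ρ.im| < T →
      ρ.re = 1 / 2 ∧ deriv riemannZeta ρ ≠ 0 :=
    fun ρ hζ h0 h1 _ ↦ zeros_onLine_simple hRH hS ρ hζ h0 h1
  -- `V(c)`, continuous in `c`, with `V(1)` the printed sum
  set V : ℝ → ℝ := fun c ↦ ∑ γ ∈ Γ', 2 * ((N γ : ℝ) / (N γ + 1)) *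
    (jurkatPeyerimhoffKernel (c * γ / T) *
      ‖1 / ((1 / 2 + γ * I) * deriv riemannZeta (1 / 2 + γ * I))‖) with hV
  have hV1 : V 1 = ∑ γ ∈ Γ', 2 * (N γ : ℝ) / (N γ + 1) * BestTrudgian2015.weight T γ := by
    simp only [hV, one_mul, BestTrudgian2015.weight, norm_div, norm_one]
    refine Finset.sum_congr rfl fun γ _ ↦ ?_
    ring
  have hVc : Tendsto V (𝓝[>] 1) (𝓝 (V 1)) := by
    refine Tendsto.mono_left (Continuous.tendsto ?_ 1) nhdsWithin_le_nhds
    refine continuous_finsetSum _ fun γ _ ↦ ?_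
    exact continuous_const.mul ((continuous_jurkatPeyerimhoffKernel.comp (by fun_prop)).mul
      continuous_const)
  have hclose : ∀ ε : ℝ, 0 < ε → ∃ c : ℝ, 1 < c ∧ |V c - V 1| < ε := by
    intro ε hε
    have h1 : ∀ᶠ c in 𝓝[>] (1 : ℝ), dist (V c) (V 1) < ε := (Metric.tendsto_nhds.1 hVc) ε hε
    obtain ⟨c, hc, hc1⟩ := (h1.and self_mem_nhdsWithin).exists
    exact ⟨c, hc1, by rwa [Real.dist_eq] at hc⟩
  rw [← hV1]
  constructor
  · intro b hb
    obtain ⟨c, hc1, hc⟩ := hclose ((V 1 - b) / 2) (by linarith)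
    have h := (frequently_normalizedMertens_of_nIndependent hz hT hΓ' hN hind hc1
      (ε := (V 1 - b) / 2) (by linarith)).1
    refine frequently_mertens_gt_of_normalizedMertens (h.mono fun y hy ↦ ?_)
    have := (abs_lt.1 hc).1
    show b < normalizedMertens y
    have hVc' : V c - (V 1 - b) / 2 < normalizedMertens y := hy
    linarith
  · intro b hb
    obtain ⟨c, hc1, hc⟩ := hclose ((b + V 1) / 2) (by linarith)
    have h := (frequently_normalizedMertens_of_nIndependent hz hT hΓ' hN hind hc1
      (ε := (b + V 1) / 2) (by linarith)).2
    refine frequently_mertens_lt_of_normalizedMertens (h.mono fun y hy ↦ ?_)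
    have := (abs_lt.1 hc).1
    show normalizedMertens y < b
    have hVc' : normalizedMertens y < -V c + (b + V 1) / 2 := hy
    linarith

/-- **Best–Trudgian 2015, Theorem 1 from the certificate of Theorem 4 (data as hypotheses).**
With Theorem 2 discharged (`BestTrudgian2015_thm2M_holds`), the tree's `BestTrudgian2015_thm1`
(`limsup M(x)x^{-1/2} ≥ 1.6383`, `liminf ≤ −1.6383`) follows from the printed input of its proof
that is a multiprecision computation, §3.4 / Theorem 4: "For our computation, we applied the main
algorithm with `k = 9000`, `n = 500` and `T ≈ γ₂₀₀₁ − ε` … the minimum candidate for `N_γ` is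
`4976`. Thus … Let `Γ'` be the heaviest 500 zeroes with `T = γ₂₀₀₁ − ε`. Then the elements of `Γ'`
are `{N_γ}`-independent, where all `N_γ`s are `4976`", together with the evaluation of the sum
(2.9) (kernel `f₀` of §3.2) for this `Γ'`, which is how the constant `1.6383` of Theorem 1 arises.
Here that input is the list of hypotheses: any height `T > 0` not an ordinate, any finite `Γ'` of
ordinates in `(0, T)`, any `N ≥ 1` with `Γ'` `{N}`-independent in `Γ ∩ [0, T]` and
`Σ_{γ∈Γ'} (2N/(N+1)) f₀(γ)/|ρζ'(ρ)| ≥ 1.6383` (so `Γ' ≠ ∅`). Unconditional in RH/simplicity: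
if either fails, (2.7) gives more (`frequently_gt_and_lt_of_nIndependent`).
[cite: BestTrudgian2015, Theorem 1 (proof, §2.1 (2.7)–(2.9)) and Theorem 4 (§3.4)] -/
theorem BestTrudgian2015_thm1_of_certificate {T : ℝ} {Γ' : Finset ℝ} {N : ℕ} (hT : 0 < T)
    (hTΓ : T ∉ zetaPositiveOrdinates) (hΓ' : ↑Γ' ⊆ zetaPositiveOrdinates ∩ Set.Ioo 0 T)
    (hN : 0 < N) (hind : BestTrudgian.NIndependent zetaPositiveOrdinates T Γ' (fun _ ↦ N))
    (hsum : (1.6383 : ℝ) ≤ ∑ γ ∈ Γ', 2 * (N : ℝ) / (N + 1) * BestTrudgian2015.weight T γ) :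
    BestTrudgian2015_thm1 := by
  have hne : Γ'.Nonempty := by
    by_contra h
    rw [Finset.not_nonempty_iff_eq_empty] at h
    rw [h, Finset.sum_empty] at hsum
    norm_num at hsum
  obtain ⟨hsup, hinf⟩ :=
    frequently_gt_and_lt_of_nIndependent BestTrudgian2015_thm2M_holds hT hTΓ hne hΓ' hN hind
  intro a ha
  refine ⟨hsup a (by linarith), (hinf (-a) (by linarith)).mono fun x hx ↦ ?_⟩
  rwa [neg_mul] at hx

end Literature.Barriers.RiemannHypothesis

end
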